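import Literature.NumberTheory.EllipticCurves.PNewBranchUntwistedGaloisLattice
import HarnessLib

/-!
# Hida, Invent. Math. 85 (1986) Thm. 2.1 (2.2b) and the FROBENIUS CHARACTERISTIC POLYNOMIALS of the reductions (2.2c) ∘ (2.1b)
# (= the remark after Thm. 2.1: «det(1 − π(σ_l)X) = 1 − t(l)X + l·t(l,l)X²») read VERBATIM on the analytic chart of
# `PNewBranchAnalyticChartTwoVariableBDP`: the big Galois lattice `π : Γ_ℚ → GL₂(ℤ_p⟦X⟧)` of the ordinary branch through a
# `p`-NEW weight-2 newform `f_E`, unramified outside `N`, whose reduction at `X = 0` has arithmetic-Frobenius characteristic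
# polynomials `X² − a_ℓ(E)X + ℓ` and whose reduction at each member point `X = x_t` has arithmetic-Frobenius characteristic
# polynomials `X² − ı_p a_ℓ(g_t) X + ℓ^{k_t−1}` (`ℓ ∤ Np`) — packaged with Castella's two-variable BDP function on the SAME
# chart (the Frobenius-currency sibling «T-An-2ᶠ» of T-An-2ᴴ / T-An-2ᵍ)

Trunk `Literature/NumberTheory/EllipticCurves`. Cell `bsd-eis` (HOME `run/shared/lean/pub/bsd-eis/`), ideator seat
`bsd-idea-12` g43, for crux 4 `BSDpOnCellC` (stmt-BirchSwinnertonDyer-19034), line «telescope» — de-assembly step 3 of the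
assembled cite stub. The sibling module `PNewBranchUntwistedGaloisLattice` (T-An-2ᴴ, p774987) states Hida's (2.2c) as
«the reduction is equivalent OVER `Ω = ℂ_p` to `V_pE` / to Deligne's representation of the member». Print is finer than
that: [Hida1986] DEFINES «`π mod P`» as the SEMI-SIMPLIFICATION of the reduction (§2, p. 557: «The reduction `π mod P` is
defined to be the semi-simplification of the combination of `π` with the reduction map … If `π mod P` is simple, then
`π mod P` coincides with the combination of `π` and the reduction map»), so reading (2.2c) as a statement about the
reduction ITSELF spends the simplicity of `π(f)` («A proof of the simplicity of `π(f)` can be found in Ribet [18]», p0016)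
and, at `X = 0`, the irreducibility of `V_pE` ([Serre1968]; rider (D7₀) of the sibling) INSIDE the cited text, together with
the identification rider `TU-ident` (Chebotarev + Brauer–Nesbitt). What (2.2c) yields with NO rider at all is the
CHARACTERISTIC POLYNOMIAL of the reduction at every Frobenius: a characteristic polynomial does not see semi-simplification,
and (2.1b) prints it: «`det(1 − π(σ_l)X) = 1 − a(l, f)X + ψ(l)l^{k−1}X²`» for «the Frobenius element `σ_l` … for each prime
`l` outside `Np`»; Hida draws exactly this consequence himself (remark after Thm. 2.1, p0017): «the assertion (2.2c) shows
that for the Frobenius element `σ_l` at each prime `l` outside `Np`, we have `det(1 − π(σ_l)X) = 1 − t(l)X + l·t(l, l)X²`».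
THIS MODULE therefore re-types the Galois clause in FROBENIUS-CHARACTERISTIC-POLYNOMIAL CURRENCY: ONE predicate WITH A BODY
`IsFrobeniusBranchGaloisLattice` (clauses (F-unr)/(F-fib₀)/(F-fib_t)/(F-rat)) and ONE named fact (`def … : Prop`, D-0014,
nothing asserted, no `_holds`) `hida1986_castella2020_exists_frobeniusGaloisLattice_on_pNewBranchChart` = T-An-2ᴴ with its
binders and analytic conjuncts TOKEN FOR TOKEN and the last conjunct `∃ π, IsFrobeniusBranchGaloisLattice W p x D π` in
place of `∃ π, IsUntwistedBranchGaloisLattice W p x D π`; nothing else. (F-unr) and (F-rat) ARE (U-unr) and (U-rat) of the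
sibling, byte for byte. No instance, no notation, no `sorry`; nothing re-declared (`FramedGaloisRep`,
`FramedGaloisRep.HasFrobCharpolyAt` (whose unfolding on the fibre matrices the (F-fib) clauses ARE), `IsArithFrobAt`,
`HeightOneSpectrum.primesAbove`, `WeierstrassCurve.frobeniusTrace`, `OrdinaryNewformDatum.charpoly`'s polynomial shape,
`evalHom`, Mathlib's `Matrix.charpoly`, `PowerSeries.constantCoeff`).
HONEST FRAMING: BSD is proved for no curve by this; no Galois representation is constructed here; crux 4 is not closed by
typing. LOGIC: the three siblings are CLASSICALLY EQUIVALENT and the inputs of both directions are theorems PROVED in the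
tree (T-An-2ᴴ ⇒ T-An-2ᶠ: conjugate matrices have
equal characteristic polynomials, plus the tree's Frobenius trace/determinant on `T_pE` and `OrdinaryNewformDatum.charpoly`;
T-An-2ᶠ ⇒ T-An-2ᴴ: the tree's recognition theorem
`FramedGaloisRep.nonempty_equiv_of_hasFrobCharpolyAt_of_finite_of_isIrreducible` — ONE irreducible and one ARBITRARY
continuous plane representation with equal Frobenius characteristic polynomials off a finite set are equivalent — fed by
the tree's PROVED irreducibility results `OrdinaryNewformDatum.isAbsolutelyIrreducible_baseChange_padicCoeffField` (Ribet
1977 Thm. (2.3), proved in the tree as `Ribet1977.thm23_isIrreducible_holds`) and, at `X = 0`, Faltings' semisimplicity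
`isSemisimpleRepresentation_rationalGaloisRepTate_holds` with `finrank_ne_one_of_stable_of_not_hasRationalCM_of_numberField`
for the non-CM curve `E` (multiplicative at `p`); both directions are provers' files on the Summits side, x2-p2, not this
module's). What improves is SOURCING: every Galois clause below is a printed formula ((2.2b); (2.2c) ∘ (2.1b), equivalently
Thm. 2.1's remark specialised at `P_{f_E}` and `P_t`), and the riders `TU-ident`, (D7₀), `TU-Ω` of the sibling DISAPPEAR
from the cited text (they become the tree theorems just named).

## Why a SIBLING fact and why ONE ∃-package — as in the sibling modules (same paragraph applies verbatim): the Galois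
clauses speak of the fibres AT THE MEMBER POINTS `x_t` against the members' data `(D t)`, so they live on the chart data
`(x, D)` that T-An-2 produces; «for every chart there is a lattice» would be STRONGER than print; one ∃ is what print does
(ONE branch `𝓘(𝒦)` carrying Hida's `π` and Castella's `L_p(𝐟)`).

## Sources, verbatim (read first-hand; held text of [Hida1986] `paper:galaxy-pdf-386122223565667620`, chunk locators in
parentheses; printed-page locators as fixed by referee bsd-eis-ref g150 for the sibling modules)

**[Hida1986]** H. Hida, *Galois representations into `GL₂(ℤ_p⟦X⟧)` attached to ordinary cusp forms*, Invent. Math. 85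
(1986) 545–613. Intro (p. 545; p0001): «Assume throughout the paper that `p ≥ 5`.» §2 (p0016): «Let `N` be a positive
integer prime to `p`. To each primitive form `f` of `S_k(Γ₀(Np^r), ψ)`, one can attach a simple representation `π = π(f)`
of the absolute Galois group `𝔊 = Gal(Q̄/Q)` into `GL₂(Ω)`, which is characterized by the following properties: (2.1a)
`π(f)` is unramified outside `Np`; (2.1b) Let `σ_l` be the Frobenius element of `𝔊` for each prime `l` outside `Np`. Then
we have that `det(1 − π(σ_l)X) = 1 − a(l, f)X + ψ(l)l^{k−1}X²`. When `k = 2`, the existence of `π(f)` follows from the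
Eichler–Shimura congruence relation [25, Th. 7.9]. More generally, this is shown by Deligne [4] for each weight `k ≥ 2` …
A proof of the simplicity of `π(f)` can be found in Ribet [18].» §2 Terminology (p. 557; p0016): continuity = «a
`𝓘(𝒦)`-lattice `L` … stable under `𝔊`» with «`π : 𝔊 → Aut_{𝓘(𝒦)}(L)` continuous»; «For each prime divisor `P` of
`𝓘(𝒦)`, … `L_P = L ⊗ 𝓘(𝒦)_P` is free of rank 2 over `𝓘(𝒦)_P` … The reduction `π mod P` is defined to be the
semi-simplification of the combination of `π` with the reduction map: `GL₂(𝓘(𝒦)_P) → GL₂(K(P))`. The reduction `π mod P`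
does not depend on the choice of the lattice `L`. If `π mod P` is simple, then `π mod P` coincides with the combination of
`π` and the reduction map.» (p0017) «We denote by `π(f)` … the Galois representation as above associated with the primitive
form corresponding to `f` via (1.9). By Corollary 1.5, one can attach to `f` a non-trivial `𝒪_K`-algebra homomorphism
`λ_f` of `𝓘(𝒦)` into `Ω`. Put `P_f = Ker(λ_f)`.» **Thm. 2.1** (p. 557; p0017): «Let `𝒦` be a primitive local ring of
`𝒽(N; K)`. Then there exists a continuous representation of `𝔊` into `GL₂(𝒦)` characterized by the following properties:
(2.2a) `π` is simple; (2.2b) `π` is unramified outside `Np`; (2.2c) For each ordinary form `f` of weight `k ≥ 2` belonging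
to `𝒦`, the reduction `π mod P_f` is equivalent to `π(f)` as a Galois representation into `GL₂(Ω)`.» and the REMARK that
follows: «Secondly, if we denote by `t(l)` and `t(l, l)` for the images of `T(l)` and `T(l, l)` in `𝒦`, then the assertion
(2.2c) shows that for the Frobenius element `σ_l` at each prime `l` outside `Np`, we have `det(1 − π(σ_l)X) = 1 − t(l)X +
l·t(l, l)X²`.» NO hypothesis on the residual representation. **§8** (pp. 594–599; p0057–p0062), **Cor. 1.3/1.4**
(pp. 554–555; p0013): as quoted in the sibling modules. **[Delbourgo2008]** Thm. 4.3 (ii), Cor. 7.3 (ii) (held book,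
chunks p0088, p0093, p0186) PRINT the same currency for the branch through `f_E`: «unramified outside of `Np` …
`det(1 − ρ_{∞,E}(Frob_l)X)|_{w=k} = 1 − a_l(f_k)X + …`». The `p = 3` sources [Wiles1988] Thm. 2.2.1 / [SkinnerWiles1999]
§3.3 (3.4) / [GhateVatsal2004] §2–§3 are quoted in the sibling module; NOTE that [SkinnerWiles1999] (3.4) (ii)–(iv)
(«`ρ_𝔔` is unramified at all primes `ℓ ∤ np`», «`trace ρ_𝔔(Frob_ℓ) = T(ℓ) mod 𝔔`», «`det ρ_𝔔(Frob_ℓ) = S(ℓ)Nm(ℓ) mod 𝔔`»)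
is ITSELF in Frobenius trace/determinant currency — the currency of this module.

## Transcription (print → the four clauses; what is VERBATIM and what is a rider)

SETTING as in the sibling modules: `W/ℚ` globally minimal, conductor `N`, newform `f = f_E` (`IsNewformOf W f`); `p` odd,
`p ∥ N` (so `f` is `p`-new and ordinary, tame level `M = N/p`); `𝒦` THE primitive component of tame level `M` through `f`
([Hida1986] Cor. 1.3), `𝓘 = 𝓘(𝒦)`; `R := ℤ_p⟦X⟧`. (F1) = (D1) [Thm. 2.1 + p. 557] Hida's `𝔊`-stable `𝓘`-lattice
`L ⊂ 𝒦²` with (2.2b), (2.2c) — PRINT. (F2) = (D2) the chart `𝕄̃ : 𝓘 → R` of T-An-1 (`IsPNewBranchAnalyticChart`; member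
points `𝔮_t = (X − x_t)`, `P_t = 𝕄̃⁻¹(𝔮_t)`, `𝕄̃⁻¹((X)) = P_{f_E}`) — its own named fact. (F3) = (D3) base change +
reflexive hull `T := ((L ⊗_𝓘 R)/torsion)^{**}`, FREE of rank 2 over the regular two-dimensional local ring `R`
([BrunsHerzog1998] 1.4.19/1.4.1, 2.2.7, 1.3.3), `𝔊` acting continuously for the product topology; a basis gives the frame
`π : Γ_ℚ →ₜ* GL₂(ℤ_p⟦X⟧)` — RIDER `TF-hull` (= `TU-hull`, classical commutative algebra ABOUT Hida's lattice).
(F4) (F-unr) = (2.2b) VERBATIM = the sibling's (U-unr), byte for byte. (F5) THE FIBRE CHARACTERISTIC POLYNOMIALS. For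
`σ ∈ 𝔊` and a height-one prime `𝔮` of `R` with `R/𝔮 = ℤ_p` (`𝔮 = (X)`: `F ↦ F(0) = constantCoeff F`; `𝔮 = 𝔮_t`:
`F ↦ F(x_t)`, the tree's `evalHom (x t)`), the characteristic polynomial of `σ` on the fibre `T/𝔮T` is the reduction mod `𝔮`
of `charpoly(σ | T) ∈ R[X]` (determinants commute with base change; `T` free), and `charpoly(σ | T) = charpoly(π(σ))`, the
image under `𝕄̃` of Hida's `det(X − π(σ)) ∈ 𝓘[X]` (`T ⊗_R Frac R = (L ⊗_𝓘 Frac R)`: same `Frac R`-representation). At a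
Frobenius `σ_l`, `l ∤ Np`, Thm. 2.1's remark gives `det(1 − π(σ_l)X) = 1 − t(l)X + l·t(l,l)X²` with `t(l) = T(l)`,
`l·t(l,l) = ψχ⁻¹(σ_l)ι(σ_l)` (p0017), whose image under `λ_{P}` (`P = P_t`, `P_{f_E}`: the algebra homomorphisms
`T(n) ↦ a(n, f_P)` of Cor. 1.5 / (1.10)) is (2.1b) for `f_P`: `1 − a(l, f_P)X + l^{k−1}X²` (trivial character: the members
and `f_E` are on `Γ₀`, (memb) of the chart) — EQUIVALENTLY, and this is how Hida phrases it, (2.2c): `(π mod P)` «is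
equivalent to `π(f_P)`», `π mod P` := the semi-simplification of the reduction, so `charpoly(reduction(σ)) =
charpoly((π mod P)(σ)) = charpoly(π(f_P)(σ))`, which at `σ = σ_l` is (2.1b). Reading `a(l, f_{P_t}) = a_l(g_t)` (the member
`g_t` is the primitive form of `f_{P_t}`, (memb); embedded by `ι_t = (D t).ι` into `ℚ̄_p`) gives (F-fib_t) in EXACTLY the
polynomial shape of the tree's `OrdinaryNewformDatum.charpoly` (`X² − ι(a_ℓ(g))X + ℓ^{k−1}` in `ℚ̄_p[X]`); reading
`a(l, f_E) = a_l(E) = l + 1 − #Ẽ(𝔽_l)` (`IsNewformOf W f`: `a_n(f) = a_n(W)`; the chart's own spelling `W.frobeniusTrace l`,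
clause (wt2) of `IsPNewBranchAnalyticChart`) gives (F-fib₀) over `ℤ_p`. BOTH (F-fib) clauses quantify exactly as the tree's
`FramedGaloisRep.HasFrobCharpolyAt v Q ρ := ∀ 𝔓 ∈ v.primesAbove, ∀ σ, IsArithFrobAt (𝓞 ℚ) σ 𝔓 → charpoly (ρ σ) = Q`,
UNFOLDED on the fibre matrices `((π σ)).map constantCoeff` / `((π σ)).map (evalHom (x t) ht)` (so that a consumer rewrites
them into `HasFrobCharpolyAt` of the base-changed framed representation by `FramedRep.coe_baseChange_apply`); the places are
restricted to `ℓ ∤ N`, `ℓ ≠ p` («outside `Np`»; under the fact's binders `p ∣ N`, so `ℓ ≠ p` is implied — it is kept so that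
the predicate reads verbatim for any `(W, p)`). NO equivalence of representations, NO field `Ω`, NO semisimplicity and NO
irreducibility is asserted. (F6) (F-rat) = the sibling's (U-rat) = (D6), byte for byte — RIDER `TF-rat`.
NOT in this statement (TREE THEOREMS, Summits side, x2-p2 g24 — the bridges T-An-2ᶠ → T-An-2ᴴ → T-An-2ᵍ): recognition of
the member fibre from its Frobenius data (`…TelescopeBranchMemberFibreOfFrobCharpoly.exists_conjOver_of_hasFrobCharpolyAt`,
p774643) and of the weight-two fibre (`…TelescopeBranchZeroFibreOfFrobCharpoly.exists_fib0_conjOver_of_hasFrobCharpolyAt`,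
p775040), with their irreducibility/semisimplicity inputs the PROVED tree theorems named under LOGIC above; then descent,
critical twist and Weierstrass remainder as listed in the sibling module.

## Flags (riders for the referee; nothing hidden)

* `TF-chain`: a CONJUNCTION of published results — T-An-2's chain (flags `T2-*`, `T1-*` of the sibling modules) +
  [Hida1986] Thm. 2.1 (2.2b), (2.2c) ∘ (2.1b) (= Thm. 2.1's remark), Cor. 1.3/1.4/1.5, §8 + the classical rider `TF-hull`
  (F3), with NO use of the residual image (crux 4: `E[p]` reducible; Hida needs none) and — NEW versus the siblings — NO
  use of [Ribet1977] / [Serre1968] / Chebotarev–Brauer–Nesbitt inside the cited text.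
* `TF-hull`: as `TU-hull`: the framed module is `((L ⊗_𝓘 ℤ_p⟦X⟧)/torsion)^{**}`, not Hida's `L(𝒦)`; no freeness over `𝓘`,
  no integral fibre isomorphism, no pairing, no ordinary filtration is claimed; (F5)'s «charpoly of the fibre = reduction
  of the big charpoly» holds for ANY free `R`-lattice in `π ⊗ Frac R`, so the hull costs nothing here.
* `TF-rat`: (F-rat) is (D6), a consequence of the integral chart (sibling flags `T1-R0`/`TG-rat`/`TU-rat`).
* `TF-conv`: the tree's Frobenius is ARITHMETIC (`IsArithFrobAt`; `trace_galoisRepTate_frobenius_eq_frobeniusTrace`: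
  `tr(Frob_ℓ | T_pE) = a_ℓ(E)`; `OrdinaryNewformDatum.charpoly`: `X² − ι(a_ℓ)X + ℓ^{k−1}`), and (F-fib) is written in that
  convention; if a reader takes Hida's `σ_l` to be geometric, replace Hida's `π` by its contragredient lattice
  `σ ↦ ᵗπ(σ)⁻¹` (again continuous, free, unramified outside `Np`): the ∃-statement is insensitive to the convention.
  `TF-unr`: (F-unr) says nothing at `p` (`p ∣ N`).
* `TF-p3`: binder `2 < p` INHERITED (flag `T1-p3`). [Hida1986] prints `p ≥ 5` (p. 545) and is the verbatim source there; at
  `p = 3` the source is [Wiles1988] §2.2 / Thm. 2.2.1 exactly as documented in the sibling module's flag `TU-p3` (provenance: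
  [Wiles1988] not held, acq-06039; number/content/odd-`p` scope confirmed first-hand in [SkinnerWiles1999] §3.3 (3.4), p. 39,
  p. 6, p. 126 and [GhateVatsal2004] pp. 2147, 2149–2150) — and there the printed statement (3.4) (ii)–(iv) IS the
  Frobenius trace/determinant statement, so at `p = 3` this module's clauses need NO identification rider either.
* RELATION TO T-An-2ᴴ / T-An-2ᵍ: see LOGIC above; the bridges are provers' files, not this module's.

## References
[Hida1986] pp. 545, 554–557, 594–599 (chunks p0001, p0013, p0016–p0017, p0057–p0062); [Hida1986ENS]; [Wiles1988] §2.2,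
Thm. 2.2.1 (odd `p`; not held, acq-06039); [SkinnerWiles1999] §3.3 (3.4), pp. 38–40, p. 6, p. 126 (held
`paper:doi-10-1007-bf02698855`, p0003, p0035–p0037, p0123); [GhateVatsal2004] §2 pp. 2147, 2149, §3 pp. 2149–2150 (held
`paper:doi-10-5802-aif-2077`, p0006, p0008–p0009); [Delbourgo2008] Thm. 4.3 (ii), Cor. 7.3 (ii) (held; p0088, p0093, p0130,
p0186); [BrunsHerzog1998] 1.3.3, 1.4.1, 1.4.19, 2.2.7; [BreuilConradDiamondTaylor2001] Thm. A (`IsNewformOf`); and the sibling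
modules' references for the analytic part ([Castella2020JIMJ], [Castella2018], [Castella2018Exceptional], [CastellaHsieh2018],
[Venerucci2016], [GreenbergStevens1993], [Skinner2016PacificMC]). Tree: `PNewBranchUntwistedGaloisLattice.lean` (T-An-2ᴴ),
`PNewBranchGaloisLattice.lean` (T-An-2ᵍ), `PNewBranchAnalyticChartTwoVariableBDP.lean` (T-An-1/T-An-2,
`IsPNewBranchAnalyticChart`), `PadicSeriesEvaluation.lean` (`evalHom`), `GlobalMinimalModel.lean` (`frobeniusTrace`),
`GreenbergSelmerNewformDatum.lean` (`OrdinaryNewformDatum.charpoly`, `padicCoeffIntegers`), `GaloisRepresentations/GaloisRep.lean`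
(`FramedGaloisRep`, `FramedGaloisRep.HasFrobCharpolyAt`, `IsUnramifiedAt`), Mathlib (`IsArithFrobAt`, `Matrix.charpoly`).
-/

noncomputable section

open scoped MatrixGroups ModularForm Topology PowerSeries.WithPiTopology

open CongruenceSubgroup NumberField IsDedekindDomain Field Filter UpperHalfPlane
  Literature.NumberTheory.GaloisRepresentations
  Literature.NumberTheory.EllipticCurves.ModularForms
  Literature.NumberTheory.EllipticCurves.GreenbergSelmer

namespace Literature.NumberTheory.EllipticCurves

/-! ### §1. Hida's (2.2b) and the fibre Frobenius characteristic polynomials (2.2c) ∘ (2.1b) on chart data (a definition with a body) -/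

/-- **A framed continuous rank-2 Galois lattice over `ℤ_p⟦X⟧` on the chart data `(x, D)`, unramified outside `N`, whose
reduction at `X = 0` has arithmetic-Frobenius characteristic polynomial `X² − a_ℓ(E)X + ℓ` and whose reduction at each
member point `X = x_t` has arithmetic-Frobenius characteristic polynomial `X² − ı_p a_ℓ(g_t)X + ℓ^{k_t−1}`, at every prime
`ℓ ∤ Np`** — [Hida1986] Thm. 2.1 (2.2b), and (2.2c) read through (2.1b) (= the remark after Thm. 2.1,
«`det(1 − π(σ_l)X) = 1 − t(l)X + l·t(l,l)X²`», specialised at `P_{f_E}` and at `P_t`), in print shape; the Galois clause of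
the named fact below. For `π : FramedGaloisRep ℚ (PowerSeries ℤ_[p]) 2` (`Γ_ℚ →ₜ* GL₂(ℤ_p⟦X⟧)`, product topology):
(F-unr) `π` is unramified at every finite place `v` of `ℚ` with `ℓ_v ∤ N` [Thm. 2.1 (2.2b); = (U-unr) of
`IsUntwistedBranchGaloisLattice`, byte for byte];
(F-fib₀) for every `v` with `ℓ_v ∤ N`, `ℓ_v ≠ p`, every prime `𝔓` of `ℚ̄` above `v` and every arithmetic Frobenius `σ` at `𝔓`
(Mathlib `IsArithFrobAt`), the reduction mod `(X)` of `π σ` — the matrix `(π σ)(0) ∈ M₂(ℤ_p)`, `F ↦ constantCoeff F` — has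
characteristic polynomial `X² − a_ℓ(E)X + ℓ ∈ ℤ_p[X]`, `a_ℓ(E) = W.frobeniusTrace ℓ = ℓ + 1 − #Ẽ(𝔽_ℓ)` (the chart's spelling,
clause (wt2) of `IsPNewBranchAnalyticChart`) [(2.2c) at `P_{f_E}` ∘ (2.1b) for `f_E` (weight 2, trivial character) ∘
`a(ℓ, f_E) = a_ℓ(E)` (`IsNewformOf`)] — this is `FramedGaloisRep.HasFrobCharpolyAt v (X² − a_ℓ(E)X + ℓ)` of the
reduction, unfolded on matrices;
(F-fib_t) for every member point `x_t` (in the open unit disc, (pts) of the chart), every `v` with `ℓ_v ∤ N`, `ℓ_v ≠ p`,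
every `𝔓 ∣ v` and every arithmetic Frobenius `σ` at `𝔓`, the reduction mod `(X − x_t)` of `π σ` — the matrix
`(π σ)(x_t) ∈ M₂(ℤ_p)`, `F ↦ F(x_t)` = the tree's `evalHom (x t)` — has characteristic polynomial mapping, under
`ℤ_p → ℚ_p → ℚ̄_p = PadicAlgCl p`, to `X² − ι_t(a_ℓ(g_t))X + ℓ^{k_t−1}` [(2.2c) at `P_t` ∘ (2.1b) for the member (Deligne),
trivial character (level `Γ₀`)] — EXACTLY the polynomial shape of `OrdinaryNewformDatum.charpoly` for `(D t).Δ`;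
(F-rat) every member is `ℚ_p`-rational under `ι_t`: `ℤ_p → 𝒪_t = padicCoeffIntegers ι_t` is onto [(D6) of the sibling modules;
= (U-rat), byte for byte].
NO equivalence of representations, no coefficient field `Ω`, no semisimplicity or irreducibility is asserted (those are
the tree theorems that turn this predicate into `IsUntwistedBranchGaloisLattice`, provers' files). A definition with a
body; asserts nothing by itself.
[cite: Hida1986, §2 (2.1a) (2.1b) and "A proof of the simplicity of π(f) can be found in Ribet (18)" (chunk p0016), §2 Terminology ("The reduction π mod P is defined to be the semi-simplification …", p. 557), Thm. 2.1 (2.2b) (2.2c) and the remark "det(1 − π(σ_l)X) = 1 − t(l)X + l t(l,l)X²" (p. 557; chunk p0017) (Invent. Math. 85 (1986))]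
[cite: Delbourgo2008, Thm. 4.3 (ii), Cor. 7.3 (ii) ("unramified outside of Np … det(1 − ρ_{∞,E}(Frob_l)X)|_{w=k} = 1 − a_l(f_k)X + …")]
[cite: SkinnerWiles1999, §3.3 (3.4) (ii)–(iv) (trace/determinant of ρ_𝔔(Frob_ℓ); p odd) — the p = 3 currency] -/
def IsFrobeniusBranchGaloisLattice (W : WeierstrassCurve ℚ) [W.IsElliptic] [W.IsGloballyMinimal] (p : ℕ) [Fact p.Prime]
    (x : ℕ → ℤ_[p]) (D : ℕ → Skinner2016.HidaCongruentForm W p 1)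
    (π : FramedGaloisRep ℚ (PowerSeries ℤ_[p]) 2) : Prop :=
  -- (F-unr) unramified at every `v ∤ N` [Hida86 Thm. 2.1 (2.2b), verbatim; = (U-unr)]
  (∀ v : HeightOneSpectrum (𝓞 ℚ),
    ¬ ((Rat.HeightOneSpectrum.primesEquiv v : Nat.Primes) : ℕ) ∣ W.conductorNorm ℤ → π.IsUnramifiedAt v) ∧
  -- (F-fib₀) the reduction mod `(X)` has arithmetic-Frobenius characteristic polynomial `X² − a_ℓ(E)X + ℓ` at every `ℓ ∤ Np`
  --          [Hida86 (2.2c) at `P_{f_E}` ∘ (2.1b) for `f_E` ∘ `a(ℓ, f_E) = a_ℓ(E)`; `FramedGaloisRep.HasFrobCharpolyAt` unfolded]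
  (∀ v : HeightOneSpectrum (𝓞 ℚ),
    ¬ ((Rat.HeightOneSpectrum.primesEquiv v : Nat.Primes) : ℕ) ∣ W.conductorNorm ℤ →
    ((Rat.HeightOneSpectrum.primesEquiv v : Nat.Primes) : ℕ) ≠ p →
    ∀ 𝔓 ∈ v.primesAbove, ∀ σ : absoluteGaloisGroup ℚ, IsArithFrobAt (𝓞 ℚ) σ 𝔓 →
      ((((π σ : GL (Fin 2) (PowerSeries ℤ_[p])) : Matrix (Fin 2) (Fin 2) (PowerSeries ℤ_[p])).map
          (fun F : PowerSeries ℤ_[p] => (PowerSeries.constantCoeff F : ℤ_[p]))).charpoly =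
        Polynomial.X ^ 2
          - Polynomial.C (((W.frobeniusTrace ((Rat.HeightOneSpectrum.primesEquiv v : Nat.Primes) : ℕ) : ℤ) : ℤ_[p])) *
              Polynomial.X
          + Polynomial.C ((((Rat.HeightOneSpectrum.primesEquiv v : Nat.Primes) : ℕ) : ℤ_[p])))) ∧
  -- (F-fib_t) the reduction mod `(X − x_t)` (the specialisation `F ↦ F(x_t)`) has arithmetic-Frobenius characteristic polynomial
  --           `X² − ι_t(a_ℓ(g_t))X + ℓ^{k_t − 1}` (read in `ℚ̄_p[X]`) at every `ℓ ∤ Np`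
  --           [Hida86 (2.2c) at `P_t` ∘ (2.1b) for the member; polynomial shape = `OrdinaryNewformDatum.charpoly`]
  (∀ (t : ℕ) (ht : ‖x t‖ < 1), ∀ v : HeightOneSpectrum (𝓞 ℚ),
    ¬ ((Rat.HeightOneSpectrum.primesEquiv v : Nat.Primes) : ℕ) ∣ W.conductorNorm ℤ →
    ((Rat.HeightOneSpectrum.primesEquiv v : Nat.Primes) : ℕ) ≠ p →
    ∀ 𝔓 ∈ v.primesAbove, ∀ σ : absoluteGaloisGroup ℚ, IsArithFrobAt (𝓞 ℚ) σ 𝔓 →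
      ((((π σ : GL (Fin 2) (PowerSeries ℤ_[p])) : Matrix (Fin 2) (Fin 2) (PowerSeries ℤ_[p])).map
          (evalHom (x t) ht)).charpoly).map ((algebraMap ℚ_[p] (PadicAlgCl p)).comp PadicInt.Coe.ringHom) =
        Polynomial.X ^ 2
          - Polynomial.C ((D t).ι ⟨(qExpansion 1 ⇑(D t).g).coeff ((Rat.HeightOneSpectrum.primesEquiv v : Nat.Primes) : ℕ),
              coeff_mem_coeffField (D t).g _⟩) * Polynomial.X
          + Polynomial.C ((((Rat.HeightOneSpectrum.primesEquiv v : Nat.Primes) : ℕ) : PadicAlgCl p) ^ ((D t).k - 1).toNat)) ∧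
  -- (F-rat) the members are `ℚ_p`-rational under `ι_t`: `ℤ_p → 𝒪_t` is onto [(D6): Hida86 Cor. 1.3/1.4 at the étale point; = (U-rat)]
  (∀ t : ℕ, Function.Surjective (algebraMap ℤ_[p] (padicCoeffIntegers (D t).ι)))

/-! ### §2. The named fact — T-An-2 with the Frobenius-currency Galois clause on the SAME chart -/

/-- **Hida 1986 Thm. 2.1 (2.2b), (2.2c) ∘ (2.1b) (with Cor. 1.3/1.4/1.5, §8) ∘ Castella 2020/2018 ∘ the chart of T-An-1 — the
ordinary branch through the `p`-NEW weight-2 newform `f_E` carries, ON ONE AND THE SAME analytic chart `(A, x, D)`,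
Castella's two-variable BDP function `L` (T-An-2, verbatim) AND a framed continuous Galois lattice
`π : Γ_ℚ →ₜ* GL₂(ℤ_p⟦X⟧)`, unramified outside `N`, whose reduction mod `(X)` has arithmetic-Frobenius characteristic
polynomials `X² − a_ℓ(E)X + ℓ` and whose reduction mod `(X − x_t)` has arithmetic-Frobenius characteristic polynomials
`X² − ı_p a_ℓ(g_t)X + ℓ^{k_t−1}`, `ℓ ∤ Np`, the members being `ℚ_p`-rational.**
Printed content: [Hida1986, Thm. 2.1] «there exists a continuous representation of `𝔊` into `GL₂(𝒦)` … (2.2b) `π` is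
unramified outside `Np`; (2.2c) For each ordinary form `f` of weight `k ≥ 2` belonging to `𝒦`, the reduction `π mod P_f`
is equivalent to `π(f)` as a Galois representation into `GL₂(Ω)`» where «the reduction `π mod P` is defined to be the
semi-simplification of the combination of `π` with the reduction map» (p. 557) and `π(f)` is characterised by «(2.1b)
`det(1 − π(σ_l)X) = 1 − a(l, f)X + ψ(l)l^{k−1}X²`» for «each prime `l` outside `Np`»; Hida's own corollary (remark after
Thm. 2.1): «the assertion (2.2c) shows that for the Frobenius element `σ_l` at each prime `l` outside `Np`, we have
`det(1 − π(σ_l)X) = 1 − t(l)X + l·t(l, l)X²`»; NO hypothesis on the residual representation; read on the chart of T-An-1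
through the transcription (F1)–(F6) of the module docstring (base change along the integral chart `𝓘 → ℤ_p⟦X⟧` and
reflexive hull, rider `TF-hull`; characteristic polynomials of the fibres at `(X)` and `(X − x_t)` = specialisations of the
big characteristic polynomial = (2.1b) for `f_E` and for the member; `a(ℓ, f_E) = a_ℓ(E)` by `IsNewformOf`; members
`ℚ_p`-rational, rider `TF-rat`). TRANSCRIPTION: under EXACTLY the binders of
`hida1986_castella2020_exists_untwistedGaloisLattice_on_pNewBranchChart` (token for token), THERE ARE chart data `(A, x, D)`
with `IsPNewBranchAnalyticChart W p ι j A x D`, the CM periods and `L` of T-An-2 with (an∞), (an_t) VERBATIM, AND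
`π : FramedGaloisRep ℚ (PowerSeries ℤ_[p]) 2` with `IsFrobeniusBranchGaloisLattice W p x D π` — for the SAME `(x, D)`;
dropping the last conjunct recovers T-An-2; the tree derives the sibling facts T-An-2ᴴ (conjugacy over `Ω`, by the
recognition theorem with Ribet's and Faltings' theorems, all proved in the tree) and T-An-2ᵍ from this one. Flags `TF-chain`,
`TF-hull`, `TF-rat`, `TF-conv`, `TF-unr`, `TF-p3` (binder `2 < p`; [Hida1986] prints `p ≥ 5`, `p = 3` by [Wiles1988]
§2.2/Thm. 2.2.1 as documented in the sibling module, where the printed statement is already in trace/determinant currency):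
module docstring. Named fact (D-0014); a conjunction of published results; nothing constructed; no `_holds`; BSD is proved
for no curve by this.
[cite: Hida1986, Intro (p. 545), Cor. 1.3, Cor. 1.4, Cor. 1.5 (pp. 554–556), §2 (2.1a) (2.1b), Terminology and the definition of "π mod P" (p. 557), Thm. 2.1 (2.2a)–(2.2c) and the remark following it (p. 557), §8 (pp. 594–599) (Invent. Math. 85 (1986))]
[cite: Delbourgo2008, Thm. 4.3 (ii), §4.2, Cor. 7.3 (ii) and the remark "equally valid at p = 3, with the proviso …" (held book, chunks p0088, p0093, p0130, p0186)]
[cite: BrunsHerzog1998, Thm. 1.3.3 (Auslander–Buchsbaum), Prop. 1.4.1, Exercise 1.4.19, Thm. 2.2.7 (Auslander–Buchsbaum–Serre)]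
[cite: Castella2020JIMJ, §1.1, §1.2, Def. 2.10, Thm. 2.11, Rem. 2.12] [cite: Castella2018, §2, Thm. 3.1, §4 (4.1), p. 11]
[cite: Castella2018Exceptional, Introduction and §3.2 Thm. 3.4] [cite: CastellaHsieh2018, §3.3 Def. 3.7 and Prop. 3.8]
[cite: Venerucci2016, §2.1, §2.4] [cite: GreenbergStevens1993, §2] [cite: Skinner2016PacificMC, §2.6]
[cite: BreuilConradDiamondTaylor2001, Thm. A (a_n(f_E) = a_n(E))]
[cite: Wiles1988, §2.2 (pseudo-representations, odd p) and Thm. 2.2.1 (ordinary Λ-adic Galois representations) (Invent. Math. 94 (1988) 529–573) — the source at p = 3]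
[cite: SkinnerWiles1999, §3.3 (3.4) (ii)–(iv) and p. 39 ("the existence of ρ_𝔔 as in the proof of (W2, Theorem 2.2.1)"; p odd, p. 6; their reference W2 = Wiles 1988, p. 126) (Publ. Math. IHES 89)]
[cite: GhateVatsal2004, §2 (p. 2147; p. 2149: "for p ≥ 5; the extension to p = 3 is sketched in (Hid93), via the method of (Wil88)") and §3 (pp. 2149–2150: ρ_F with P(ρ_F) ≅ ρ_f) (Ann. Inst. Fourier 54)] -/
def hida1986_castella2020_exists_frobeniusGaloisLattice_on_pNewBranchChart : Prop :=
  ∀ {p : ℕ} [Fact p.Prime] (ι : PadicAlgCl p ≃+* ℂ) (W : WeierstrassCurve ℚ) [W.IsElliptic]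
    [W.IsGloballyMinimal] (K : Type) [Field K] [NumberField K]
    (𝔭 : HeightOneSpectrum (𝓞 K)) (κ : ZpExtension K p) (γ : absoluteGaloisGroup K)
    [Fact (κ.IsTopGenerator γ)] {N : ℕ} [NeZero N] {f : CuspForm (Gamma0 N) 2}
    (_ : IsNewformOf W f),
    -- `f = f_E` of level `N`, `p` an ODD prime with `p ∥ N` (tame level `M = N/p`, `f` `p`-stabilised-new and ordinary)
    W.conductorNorm ℤ = N → 2 < p → W.HasMultiplicativeReductionAtPrime p →
    -- `K` imaginary quadratic, `d_K` odd and `< −4`, every prime of `N = Mp` split in `K` (Heegner for `M`, and `p = 𝔭𝔭̄` split)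
    IsImaginaryQuadratic K → Odd (NumberField.discr K) → NumberField.discr K < -4 →
    SatisfiesHeegnerHypothesis N K →
    ((Ideal.span {(p : ℤ)}).primesOver (𝓞 K)).ncard = 2 →
    -- `𝔭` the prime above `p` induced by `ı_p = ι⁻¹`
    ((p : ℕ) : 𝓞 K) ∈ 𝔭.asIdeal →
    (∀ (w : InfinitePlace K) (y : 𝓞 K), y ∈ 𝔭.asIdeal ↔ ‖ι.symm (w.embedding (y : K))‖ < 1) →
    -- `Γ` THE anticyclotomic `ℤ_p`-extension (`γ` a topological generator, `1 + T ↔ γ`)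
    κ.IsAnticyclotomic →
    -- the structure map `j : ℤ_p → R₀` of the chart (characterised by its values in `ℂ_p`)
    ∀ (j : ℤ_[p] →+* unrIntegers p),
      (∀ z : ℤ_[p], ((j z : unrIntegers p) : ℂ_[p]) = algebraMap ℚ_[p] ℂ_[p] (z : ℚ_[p])) →
    ∃ (A : ℕ → UnrSeries p) (x : ℕ → ℤ_[p]) (D : ℕ → Skinner2016.HidaCongruentForm W p 1),
      -- the chart and the members [Hida86 / GS93: T-An-1's clauses]
      IsPNewBranchAnalyticChart W p ι j A x D ∧
      -- T-An-2 VERBATIM: CM periods and `L = L_p(𝐟)` read on the chart, with (an∞) and (an_t)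
      (∃ (ΩK : ℂ) (Ωp : (unrIntegers p)ˣ) (L : PowerSeries (PowerSeries (unrIntegers p))),
        ΩK ≠ 0 ∧
        -- (an∞) the weight-2 (`X = 0`, `p`-new) fibre generates the ideal of Castella's `L_p(f)` [Cas18 (4.1) at `𝐟_φ = f`, p. 11; Thm. 3.1]
        (∃ L₂ : UnrSeries p, IsBDPLFunction ι 𝔭 κ γ f ΩK ((Ωp : unrIntegers p) : ℂ_[p]) L₂ ∧
          Ideal.span {PowerSeries.map (PowerSeries.constantCoeff (R := unrIntegers p)) L} =
            Ideal.span {L₂}) ∧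
        -- (an_t) the fibre at the member point `x_t` generates the ideal of the member's BDP function, SAME periods [Cas18 (4.1); Cas20 Thm. 2.11]
        (∀ t : ℕ, ∃ (Ψ Lg : UnrSeries p),
          (∃ U : PowerSeries (PowerSeries (unrIntegers p)),
            PowerSeries.map (PowerSeries.C (R := unrIntegers p)) Ψ =
              L + PowerSeries.C (PowerSeries.X - PowerSeries.C (j (x t))) * U) ∧
          IsBDPLFunctionWt ι 𝔭 κ γ (D t).g ΩK ((Ωp : unrIntegers p) : ℂ_[p]) Lg ∧
          Ideal.span {Ψ} = Ideal.span {Lg})) ∧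
      -- NEW [Hida86 Thm. 2.1 (2.2b), (2.2c) ∘ (2.1b) on the same branch, VERBATIM]: the Frobenius-currency lattice on the SAME `(x, D)`
      ∃ π : FramedGaloisRep ℚ (PowerSeries ℤ_[p]) 2, IsFrobeniusBranchGaloisLattice W p x D π

end Literature.NumberTheory.EllipticCurves

end
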